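import Summits.CriticalPhenomena.Ising3DConformalLimit.Theses.FKParityRobustness
import Literature.Probability.LatticeModels.RandomClusterDomainMarkovFree

/-!
# Skeleton line `disjoint-crossing-tails` (gen 2) for crux `FKFourConnectivity` (stmt-CriticalPhenomena-11254)

Route `FKParityRobustness`, crux r3 `FKFourConnectivity` = P4 (FK four-point hyperscaling at the
tetrahedron): `∃ c > 0 ∀ l ≥ 1 ∃ N₀ ∀ N ≥ N₀ ∀ a = l·tetra ⊂ Λ_N :
c · φ_N[a₀ ↔ a₁] · φ_N[a₂ ↔ a₃] ≤ φ_N[all four aᵢ joined]`, `φ_N` the FREE critical FK-Ising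
measure `rcMeasure ((zdGraph 3).comap Subtype.val) (fkIsingParam (criticalBeta 3)) 2 ∅` of the box
graph on `↥(box 3 N)` (= `finsetGraph (zdGraph 3) (box 3 N)` of the tree, definitionally).

## The line (idea card `Ideas/disjoint-crossing-tails.md`; triage r1: pass ×3 as the
"cluster-count module; the pinned crux needs one more device")

LEVER — a van den Berg–Kesten SUBSTITUTE for the free random-cluster measure, `q ≥ 1`
(`stub_disjointCrossingTail`, DCT, provable now): `k` DISTINCT open clusters each meeting `S` and
`T` cost `φ⁰[S ↔ T]^k`.  Proof by a stopping-set exploration (NO FKG, NO BK): explore the clusters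
of the vertices of `S` in a fixed order up to and including the first one that meets `T`; the
explored union `W` has closed edge boundary, so given the exploration the rest of the configuration
is the FREE measure of the sub-domain `Λ ∖ W` (`rcMeasure_real_free_restrict_inter_outerClosed`);
the remaining `k − 1` distinct `S–T` clusters live there; induct (over all sub-domains `Λ' ⊆ Λ` at
once) and use that the ONE-cluster event `{S ↔ T}` is increasing, so
`φ⁰_{Λ∖W}[S ↔ T] ≤ φ⁰_Λ[S ↔ T]` (`rcMeasure_real_free_le_restrict`, Grimmett (4.24)).  (The event
"`≥ k` distinct crossing clusters" is NOT monotone — clusters merge — which is why the argument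
never applies FKG or domain-monotonicity to it, only to `{S ↔ T}`; this corrects the FKG variant
suggested in triage r1-2 and follows triage r1-1.)

INPUT no. 1 (open, d = 3) — `stub_annulusNotSure` (ANS): ONE number, the critical FK-Ising annulus
`A(⌊εl⌋, l)` of `ℤ³` is crossed with probability `≤ θ < 1` uniformly in `l` (for some `ε > 0`).
DCT + ANS ⇒ geometric tails for the number `N_ε(l)` of macroscopic clusters meeting the ball `B_l`
(`stub_clusterCountTight`, TIGHT: covering of `B_l` by `M(ε)` translated annuli + pigeonhole +
DCT + free-domain monotonicity/translation to centre the annulus), and TIGHT alone ⇒ the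
BALL-AVERAGED four-point hyperscaling (`stub_fourthMomentBound`, AVG4 — the
Borgs–Chayes–Kesten–Spencer fourth-moment bound run for FK-Ising, with NO two-point regularity
input): `c · S2far² ≤ F4all`, where `S2far = Σ_{x,y ∈ B_l, ‖x−y‖∞ ≥ ⌈εl⌉} φ_N[x ↔ y]` and
`F4all = Σ_{x ∈ B_l⁴} φ_N[x joined] = E Σ_C |C ∩ B_l|⁴` (every far connected pair lies in a big
cluster; Cauchy–Schwarz twice; `E N_ε ≤ M²/(1−θ)`).

TRANSFER to the crux's two-point functions — `stub_farPairComparison` (CMP, provable now, NEW in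
gen 2: no two-point doubling needed): for `ε ≤ 1/8`, `c · l⁶ · φ_N[u ↔ v] ≤ S2far(N, l, ⌈εl⌉)` for
all `u, v ∈ B_l` at sup-distance `≥ l`, from the Messager–Miracle-Solé sup-norm comparison of the
tree (`twoPointPlus_le_of_mul_supNorm_le`: `‖v−u‖∞ ≥ 3‖y−x‖∞ ⇒ S(v−u) ≤ S(y−x)`) applied to the
`≥ c l⁶` ordered pairs `x, y ∈ B_l` with `⌈εl⌉ ≤ ‖y−x‖∞ ≤ ⌊l/3⌋`, plus the box transfer
`½ S(y−x) ≤ φ_N[x↔y]`, `φ_N[u↔v] ≤ S(v−u)` (Edwards–Sokal + `BoxTwoPointTransfer` + free = plus at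
`β_c`).  So the shared open crux `MirrorHoelderCompactness.TwoPointDoubling`, which gen 1 of this
line registered as a marker stub, is NOT a dependency of the line any more.

INPUT no. 2 (open, d = 3, LOAD-BEARING) — `stub_noColdTetrahedron` (ST): the all-shape four-point
mass of the ball at scale `l` is at most `C · l¹²` times the pinned tetrahedral `P4`:
`F4all(N, l) ≤ C · l¹² · φ_N[l·tetra joined]`.  ST is `G`-free (two four-point quantities at the
SAME scale), Monte-Carlo decidable, FAILS in a massive phase (Steiner tree), HOLDS in the
`N(l) → ∞` enemy world of the crux (there `F4all ≈ l¹²G²/N ≈ l¹²·P4(tetra)`), and is implied by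
the crux given UV-regularity of the two-point function (Lebowitz ceiling `P4 ≤ Σ_π φφ`, landed as
`Theorems/FKFourConnectivity/Negative/EdwardsSokalFour.lean` / `LebowitzSandwich.lean`).  Hence the
crux splits into two ORTHOGONAL failure modes: (E1) many macroscopic clusters — excluded by ANS via
the BK substitute; (E2) a cold tetrahedron among scale-`l` quadruples — excluded by ST.

`FKFourConnectivity_of` composes (real algebra, kernel-checked, no `sorry`): with `ε = 1/8`,
`c₁·S2far² ≤ F4all ≤ max C 1 · l¹² · P4(a)`, `c₂ l⁶ φ[a₀↔a₁] ≤ S2far`, `c₂ l⁶ φ[a₂↔a₃] ≤ S2far`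
(the tetrahedral pairs are far pairs of `B_l`: `tetra_inBall`, `tetra_far01`, `tetra_far23`), so
`(c₁c₂²/max C 1) · φ[a₀↔a₁]·φ[a₂↔a₃] ≤ P4(a)` after cancelling `l¹² > 0`.

## Stubs (6; sizes are guesses; "provable now" = from the tree + the named antecedents)

* `stub_disjointCrossingTail` (DCT; M–L, provable now, `q ≥ 1`-uniform) — the BK substitute.
* `stub_annulusNotSure` (ANS; OPEN, d = 3 input no. 1; one monotone event at one pair of scales).
* `stub_clusterCountTight` (DCT → ANS → TIGHT; M, provable now).
* `stub_fourthMomentBound` (TIGHT → AVG4; L, provable now; no regularity input).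
* `stub_farPairComparison` (CMP; M, provable now from MMS + box transfer; no doubling).
* `stub_noColdTetrahedron` (ST; OPEN, LOAD-BEARING, d = 3 input no. 2 — the HARDEST stub).

Registrar hygiene (gen 2): no stub statement contains `let`/`:=` (gen 1's registered signatures were
truncated at `(let φ`); every stub is stated over tree declarations only (`box`, `Site`, `zdGraph`,
`finsetGraph`, `rcMeasure`, `fkIsingParam`, `criticalBeta`, `openGraph`, `openConn`), so a
`Theorems/` file can restate it verbatim and `exact` discharges the `sorry` here.

## Disproof used (`Cruxes/FKFourConnectivity/Disproof.lean` v4, 2026-08-16T02:13Z, sorry-free;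
landed `Theorems/FKFourConnectivity/Negative/{LebowitzSandwich,EdwardsSokalFour}.lean`)

* No `_false_without_` theorem, no `-- Targets`, no refuted strengthening exist — nothing to honour
  by a named stub; no stub is an instance of a landed Negative lemma (both landed files are
  NECESSITY/ceiling theorems: `|U₄|_FK ≤ 2P4`, `P4 ≤ Σ_π φφ` ⇒ `r(l) ≤ 3`; all constants here are
  existential, and summed over `B_l⁴` the ceiling is the Lebowitz direction `crux ⇒ ST`).
* LOAD-BEARING census honoured: SHAPE enters through CMP's hypothesis `‖u − v‖∞ ≥ l` (void for
  coincident pairs, cf. `openConn_self`, `allJoined_const`) and through ST (tetrahedron by value);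
  CRITICALITY sits in ST (false in a massive phase) and in ANS's numerics; `q = 2` enters the
  `crux ⇒ ST` direction; DCT/TIGHT/AVG4 are honestly `q ≥ 1`-uniform and claimed only as the
  cluster-count half (barrier `RandomClusterFirstOrder`: at a first-order point ANS and TIGHT hold,
  ST fails, and indeed `P4/G² → 0` there — the chain breaks where the barrier says).
* `d = 3`: ANS fails for `d ≥ 7` (≍ `L^{d−6}` spanning clusters, Aizenman 1997; barrier
  `SpanningClustersAboveSix`) — the input, not the lever, carries the dimension (`d_c = 6` for FK
  geometry, as the disprover's census says).
* Transport lemmas of Disproof §2b (`isingTwoPoint_boxGraph`, `univ_map_subtype_box`) are exactly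
  the box-graph ↔ `ℤ³`-in-the-box step of CMP's proof route.
-/

noncomputable section

open MeasureTheory Finset
open Literature.Probability.LatticeModels Literature.Probability.Percolation
open Summit.CriticalPhenomena.Ising3DConformalLimit.Theses.FKParityRobustness

namespace Summit.CriticalPhenomena.Ising3DConformalLimit.Cruxes.FKFourConnectivity.DisjointCrossingTails

open scoped Classical BigOperators

/-! ### Vocabulary (plain definitions over the tree; the registered stubs below INLINE all of it) -/

/-- Vertex type of the box `Λ_N = {−N..N}³`. -/
abbrev BoxV (N : ℕ) : Type := ↥(box 3 N)

/-- The nearest-neighbour graph induced on `Λ_N` (verbatim the crux's `let G`;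
= `finsetGraph (zdGraph 3) (box 3 N)` of the tree, definitionally). -/
abbrev boxGraph (N : ℕ) : SimpleGraph (BoxV N) := (zdGraph 3).comap (Subtype.val : BoxV N → Site 3)

/-- The free critical FK-Ising measure of `Λ_N` (verbatim the crux's `let φ`). -/
abbrev phiN (N : ℕ) : Measure (BondConfig (BoxV N)) :=
  rcMeasure (boxGraph N) (fkIsingParam (criticalBeta 3)) 2 ∅

/-- The unit tetrahedron of the route (verbatim the crux's `let tetra`). -/
def tetra : Fin 4 → Site 3 := ![![-1, -1, -1], ![1, 1, -1], ![1, -1, 1], ![-1, 1, 1]]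

/-- `x` lies in the sup-norm ball of radius `l` about the origin. -/
abbrev InBall (l : ℕ) (x : Site 3) : Prop := ∀ t, |x t| ≤ (l : ℤ)

/-- `x` and `y` are at sup-norm distance `≥ r`. -/
abbrev Far (r : ℕ) (x y : Site 3) : Prop := ∃ t, (r : ℤ) ≤ |x t - y t|

/-- `k` DISTINCT open clusters each meeting `S` and `T`: `k` points of `S`, pairwise NOT connected,
each connected to `T`.  For `k = 0` this is the sure event.  (Not a monotone event.) -/
def DisjArms {V : Type*} (ω : BondConfig V) (k : ℕ) (S T : Set V) : Prop :=
  ∃ x : Fin k → V, (∀ i, x i ∈ S) ∧ (∀ i j, i ≠ j → ¬ (openGraph ω).Reachable (x i) (x j)) ∧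
    ∀ i, ∃ y ∈ T, (openGraph ω).Reachable (x i) y

/-- At least `k` BIG clusters meet `B_l`: `k` pairwise disconnected points of `B_l ∩ Λ_N`, each
joined to a point of `Λ_N` at sup-distance `≥ r` from it (so its cluster has sup-diameter `≥ r`). -/
def BigClusters (N l r k : ℕ) : Set (BondConfig (BoxV N)) :=
  {ω | ∃ x : Fin k → BoxV N, (∀ i, InBall l (x i)) ∧
    (∀ i j, i ≠ j → ¬ (openGraph ω).Reachable (x i) (x j)) ∧
    ∀ i, ∃ y : BoxV N, Far r y (x i) ∧ (openGraph ω).Reachable (x i) y}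

/-- Finite-volume two-point connectivity `φ_N[x ↔ y]` (`= ⟨σ_xσ_y⟩^free_{Λ_N, β_c}` by Edwards–Sokal). -/
def Gtwo (N : ℕ) (x y : BoxV N) : ℝ := (phiN N).real (openConn x y)

/-- Finite-volume four-point connectivity `φ_N[x₀, x₁, x₂, x₃ all joined]` (the crux's event at `x = a`). -/
def P4 (N : ℕ) (x : Fin 4 → BoxV N) : ℝ := (phiN N).real {ω | ∀ i j, (openGraph ω).Reachable (x i) (x j)}

/-- Far-pair two-point mass of the ball: `S2far = Σ_{x,y ∈ B_l, ‖x−y‖∞ ≥ r} φ_N[x ↔ y]`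
(= `E #{far connected ordered pairs of B_l}`). -/
def S2far (N l r : ℕ) : ℝ :=
  ∑ x : BoxV N, ∑ y : BoxV N, if InBall l x ∧ InBall l y ∧ Far r x y then Gtwo N x y else 0

/-- All-shape four-point mass of the ball: `F4all = Σ_{x ∈ B_l⁴} φ_N[x joined]`
(= `E Σ_C |C ∩ B_l|⁴`, ordered quadruples with repetition). -/
def F4all (N l : ℕ) : ℝ :=
  ∑ x : Fin 4 → BoxV N, if (∀ i, InBall l (x i)) then P4 N x else 0

/-- `φ_N[x ↔ y] ≥ 0`. -/
theorem Gtwo_nonneg (N : ℕ) (x y : BoxV N) : 0 ≤ Gtwo N x y := by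
  unfold Gtwo
  exact measureReal_nonneg

/-- `φ_N[x joined] ≥ 0`. -/
theorem P4_nonneg (N : ℕ) (x : Fin 4 → BoxV N) : 0 ≤ P4 N x := by
  unfold P4
  exact measureReal_nonneg

/-! ### The stub STATEMENTS as named `Prop`s (readable form; the registered `stub_*` theorems below
restate them with everything inlined over tree declarations, and `*_holds` checks they agree
definitionally) -/

/-- DCT — the free-measure BK substitute ("distinct clusters cost the product"): for every graph
`G` on a type `V`, every finite sub-domain `Λ : Finset V`, `0 ≤ p ≤ 1`, `q ≥ 1`, FREE wiring, all
`S T ⊆ Λ` and `k`: `φ⁰_Λ[k distinct open clusters each meeting S and T] ≤ φ⁰_Λ[S ↔ T]^k`. -/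
def DisjointCrossingTail : Prop :=
  ∀ (V : Type) [DecidableEq V] (G : SimpleGraph V) [DecidableRel G.Adj] (Λ : Finset V) (p q : ℝ),
    p ∈ Set.Icc (0 : ℝ) 1 → 1 ≤ q → ∀ (S T : Set ↥Λ) (k : ℕ),
      (rcMeasure (G.comap (Subtype.val : ↥Λ → V)) p q (∅ : Set ↥Λ)).real {ω | DisjArms ω k S T} ≤
        ((rcMeasure (G.comap (Subtype.val : ↥Λ → V)) p q (∅ : Set ↥Λ)).real
          {ω | ∃ x ∈ S, ∃ y ∈ T, (openGraph ω).Reachable x y}) ^ k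

/-- ANS — the critical FK-Ising annulus `A(⌊εl⌋, l)` of `ℤ³` is NOT SURE to be crossed: one `θ < 1`
bounds `φ⁰_N[B_{⌊εl⌋} ↔ {‖y‖∞ ≥ l}]` for all `l ≥ 1` and all large `N`. -/
def AnnulusNotSure : Prop :=
  ∃ ε θ : ℝ, 0 < ε ∧ θ < 1 ∧ ∀ l : ℕ, 1 ≤ l → ∃ N₀ : ℕ, ∀ N : ℕ, N₀ ≤ N →
    (phiN N).real {ω | ∃ x y : BoxV N, InBall ⌊ε * l⌋₊ x ∧ (∃ t, (l : ℤ) ≤ |(y : Site 3) t|) ∧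
      (openGraph ω).Reachable x y} ≤ θ

/-- TIGHT — geometric tails for the number of macroscopic clusters: for every `ε > 0` there are
`M` and `θ ∈ [0,1)` with `φ_N[≥ M·k clusters of sup-diameter ≥ ⌈εl⌉ meet B_l] ≤ M θ^k`
for all `l ≥ 1`, `N ≥ N₀(l)`, `k`. -/
def ClusterCountTight : Prop :=
  ∀ ε : ℝ, 0 < ε → ∃ (M : ℕ) (θ : ℝ), 0 ≤ θ ∧ θ < 1 ∧ ∀ l : ℕ, 1 ≤ l → ∃ N₀ : ℕ, ∀ N : ℕ, N₀ ≤ N →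
    ∀ k : ℕ, (phiN N).real (BigClusters N l ⌈ε * l⌉₊ (M * k)) ≤ M * θ ^ k

/-- AVG4 — ball-averaged four-point hyperscaling (the BCKS fourth-moment bound): for every `ε > 0`
there is `c > 0` with `c · S2far(N, l, ⌈εl⌉)² ≤ F4all(N, l)` for all `l ≥ 1`, `N ≥ N₀(l)`. -/
def FourthMomentBound : Prop :=
  ∀ ε : ℝ, 0 < ε → ∃ c : ℝ, 0 < c ∧ ∀ l : ℕ, 1 ≤ l → ∃ N₀ : ℕ, ∀ N : ℕ, N₀ ≤ N →
    c * S2far N l ⌈ε * l⌉₊ ^ 2 ≤ F4all N l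

/-- CMP — no hot far pair (Messager–Miracle-Solé): for `0 < ε ≤ 1/8`, the far-pair two-point mass
of `B_l` dominates `l⁶ · φ_N[u ↔ v]` for every pair `u, v ∈ B_l` at sup-distance `≥ l`. -/
def FarPairComparison : Prop :=
  ∀ ε : ℝ, 0 < ε → ε ≤ 1 / 8 → ∃ c : ℝ, 0 < c ∧ ∀ l : ℕ, 1 ≤ l → ∃ N₀ : ℕ, ∀ N : ℕ, N₀ ≤ N →
    ∀ u v : BoxV N, InBall l u → InBall l v → Far l u v →
      c * (l : ℝ) ^ 6 * Gtwo N u v ≤ S2far N l ⌈ε * l⌉₊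

/-- ST — NO COLD TETRAHEDRON (load-bearing, open): the all-shape four-point mass of the ball at
scale `l` is at most `C l¹²` times the pinned tetrahedral four-point connectivity. -/
def NoColdTetrahedron : Prop :=
  ∃ C : ℝ, ∀ l : ℕ, 1 ≤ l → ∃ N₀ : ℕ, ∀ N : ℕ, N₀ ≤ N → ∀ a : Fin 4 → BoxV N,
    (∀ i, ((a i : Site 3)) = (l : ℤ) • tetra i) → F4all N l ≤ C * (l : ℝ) ^ 12 * P4 N a

/-! ### The registered stubs (verbatim over tree declarations; `sorry` only here) -/

/-- STUB DCT (M–L, provable now, `q ≥ 1`-uniform) — `DisjointCrossingTail`, inlined: for every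
graph `G` on `V`, finite sub-domain `Λ`, `0 ≤ p ≤ 1`, `q ≥ 1`, FREE wiring, and all `S T k`,
`φ⁰_Λ[∃ k points of S, pairwise not connected, each connected to T] ≤ φ⁰_Λ[S ↔ T]^k`.
Proof route (stopping-set exploration; no FKG, no BK): the event is `{N_{ST} ≥ k}`, `N_{ST}` =
number of open clusters meeting both `S` and `T` (distinct clusters ↔ pairwise not connected).
Enumerate `S`; explore the clusters `C(s₁), C(s₂), …` in order up to and including the first one
meeting `T`; the explored union `W` (a union of clusters) has all edges of `∂_E W` closed, so
`{exploration = (i, W)}` is measurable w.r.t. edges touching `W` and, given it, the configuration on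
`E(Λ ∖ W)` is the free measure of `finsetGraph G (Λ ∖ W)`
(`rcMeasure_real_free_restrict_inter_outerClosed`); on `{N_{ST} ≥ k+1}` the other `≥ k` distinct
`S–T` clusters are clusters of that sub-configuration, so
`φ⁰_Λ[N ≥ k+1] = Σ_{(i,W)} φ⁰_Λ[expl = (i,W)] · φ⁰_{Λ∖W}[N' ≥ k] ≤ (Σ … ) · sup_W φ⁰_{Λ∖W}[N' ≥ k]`
with `Σ_{(i,W)} φ⁰_Λ[expl = (i,W)] = φ⁰_Λ[N ≥ 1] = φ⁰_Λ[S ↔ T]`; induct on `k` SIMULTANEOUSLY for all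
sub-domains `Λ' ⊆ Λ` (the statement quantifies over all `Λ`), closing with
`φ⁰_{Λ'}[S' ↔ T'] ≤ φ⁰_Λ[S ↔ T]` for the INCREASING event `{S ↔ T}`
(`rcMeasure_real_free_le_restrict`, Grimmett (4.24)).  Degenerate cases: `k = 0` (`1 ≤ 1`),
`p ∈ {0,1}`, `S ∩ T ≠ ∅` (both sides `1`), empty `Λ` all hold.  SHORTEST ROUTE IN THE TREE: this
exploration is already PROVED in cylinder form as `rcMeasure_real_regionArms_le_pow_mul`
(RandomClusterMultiCrossing.lean: `j` separated crossing clusters cost `θ^j` given a one-crossing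
bound uniform over sub-regions `U ⊆ U₀` and insulated outside configurations `η`); instantiate
`B = ∅`, `T = ∅`, `U₀ = E(Λ)`, `F = univ`, `η = ∅` (so `regionCyl U₀ ∅ = univ`, local = global,
`regionArms U₀ In Out k` = this event with `In = S`, `Out = T` as Finsets), and discharge its
hypothesis: for insulated `(U, η)` (with `T = ∅`: no edge of `η` touches a vertex of an edge of
`U`) the cylinder law of `ω ∩ U` given `{ω ∖ U = η}` is EXACTLY the free measure of the spanning
graph `⟨U⟩ = fromEdgeSet U` on the same vertex type (cluster counts add: `k(ω) = k(ω ∩ U) − c(η)`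
with `c(η)` independent of `ω ∩ U`, since `η` only joins vertices that `⟨U⟩` leaves isolated — the
free-boundary analogue of `rcMeasure_real_inter_cylinder_eq_mul_fromEdgeSet_of_reachable`,
RandomClusterExploredWiring.lean, same proof via `rcPartitionFunction_mul_real_inter_cylinder`),
and `φ⁰_{⟨U⟩}[S ↔ T in U] = φ⁰_Λ[S ↔ T in U | E(Λ) ∖ U closed] ≤ φ⁰_Λ[S ↔ T] =: θ` because the
crossing event is increasing and "`E(Λ) ∖ U` closed" is decreasing
(`rcMeasure_real_inter_le_of_isLowerSet`, the FKG corollary behind `rcMeasure_real_free_le_restrict`).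
A `LinearOrder` on `↥Λ` is obtained from `Fintype.equivFin`.
Reusable by ParityRobustMerging (11253) and SourceTrailsMeet (11255). -/
theorem stub_disjointCrossingTail :
    ∀ (V : Type) [DecidableEq V] (G : SimpleGraph V) [DecidableRel G.Adj] (Λ : Finset V) (p q : ℝ),
      p ∈ Set.Icc (0 : ℝ) 1 → 1 ≤ q → ∀ (S T : Set ↥Λ) (k : ℕ),
        (rcMeasure (G.comap (Subtype.val : ↥Λ → V)) p q (∅ : Set ↥Λ)).real
            {ω | ∃ x : Fin k → ↥Λ, (∀ i, x i ∈ S) ∧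
              (∀ i j, i ≠ j → ¬ (openGraph ω).Reachable (x i) (x j)) ∧
              ∀ i, ∃ y ∈ T, (openGraph ω).Reachable (x i) y} ≤
          ((rcMeasure (G.comap (Subtype.val : ↥Λ → V)) p q (∅ : Set ↥Λ)).real
            {ω | ∃ x ∈ S, ∃ y ∈ T, (openGraph ω).Reachable x y}) ^ k := by
  sorry

/-- STUB ANS (OPEN; d = 3 critical input no. 1) — `AnnulusNotSure`, inlined: there are `ε > 0` and
`θ < 1` such that for every `l ≥ 1` and all large `N`, under the free critical FK-Ising measure of
`Λ_N ⊂ ℤ³`, `φ_N[some x with ‖x‖∞ ≤ ⌊εl⌋ is connected to some y with ‖y‖∞ ≥ l] ≤ θ`.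
Why plausible: hyperscaling (number of clusters of diameter ≥ l meeting `B_l` is tight, each is a
`d_f = 2.48`-dimensional fractal, so `φ[B_{εl} ↔ ∂B_l] ≍ ε^{3−d_f} → 0`); FK-Ising cluster numerics
(arXiv:1811.03358: O(1) spanning clusters, standard FSS).  Why it might fail: `1 − θ_l ~ l^{−a}`
(annuli become sure to be crossed) — the N(l) → ∞ world; `θ⁰(p_c) = 0` (ADS2015) does NOT imply it
(triage r1-2).  Must use d < 6 (false for d ≥ 7: Aizenman 1997, barrier
`SpanningClustersAboveSix`).  Small `l`: inner ball `{0}` when `⌊εl⌋ = 0` (probability < 1, fine);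
`N < l` makes the event empty.  (A weaker `m`-cluster variant — "the annulus is not sure to be
crossed by `m` DISTINCT clusters" with the block form of DCT, exploring the first `m` crossing
clusters — would need that bound UNIFORMLY over sub-domains `Λ' ⊆ Λ_N`, because `{≥ m clusters}` is
not monotone; reshape to it only if Monte Carlo ever shows `θ(ε)` creeping to `1`.)
MC deciders: `θ(⌊εl⌋ → l)`, `θ(l → 3l)` and the distinct-crossing-cluster histogram in kit jobs
j009271/j009274 (ideator 2), j010132 (triager r1-1). -/
theorem stub_annulusNotSure :
    ∃ ε θ : ℝ, 0 < ε ∧ θ < 1 ∧ ∀ l : ℕ, 1 ≤ l → ∃ N₀ : ℕ, ∀ N : ℕ, N₀ ≤ N →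
      (rcMeasure ((zdGraph 3).comap (Subtype.val : ↥(box 3 N) → Site 3))
          (fkIsingParam (criticalBeta 3)) 2 ∅).real
        {ω | ∃ x y : ↥(box 3 N), (∀ t, |(x : Site 3) t| ≤ ⌊ε * l⌋₊) ∧
          (∃ t, (l : ℤ) ≤ |(y : Site 3) t|) ∧ (openGraph ω).Reachable x y} ≤ θ := by
  sorry

/-- STUB TIGHT (M, provable now GIVEN its two antecedents) — `DisjointCrossingTail → AnnulusNotSure →
ClusterCountTight`, all inlined: for every `ε > 0` there are `M`, `θ ∈ [0,1)` with
`φ_N[∃ M·k points of B_l, pairwise disconnected, each joined to sup-distance ≥ ⌈εl⌉] ≤ M θ^k`.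
Proof route: let `(ε₀, θ₀)` be given by ANS (it forces `ε₀ < 1`, else the ANS event is sure at
`l = 1`), `r = ⌈εl⌉`, `l' = ⌊r/2⌋`, `ρ = ⌊ε₀ l'⌋` (so `ρ + l' ≤ r` and `ρ ≤ ⌊ε₀ l'⌋`).  Cover
`B_l` by the `M` balls `B_ρ(z)`, `z ∈ ((ρ+1)ℤ)³ ∩ B_{l+ρ}` (`M ≤ (2l/(ρ+1) + 3)³`, bounded in `l`
since `ρ ≍ ε₀ ε l / 2`; for the finitely many small `l` with `l' = 0` take `M > (2l+1)³` so that
`M·k` pairwise-disconnected — hence distinct — points of `B_l` cannot exist for `k ≥ 1`).  A cluster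
through `x ∈ B_ρ(z)` reaching sup-distance `≥ r` from `x` reaches sup-distance `≥ r − ρ ≥ l'` from
`z`, i.e. crosses the translated annulus `B_ρ(z) → {‖· − z‖∞ ≥ l'}`; by pigeonhole `M·k` distinct
big clusters put `k` distinct crossing clusters on one annulus `A_z`; DCT (with `V = Site 3`,
`G = zdGraph 3`, `Λ = box 3 N`, `S = B_ρ(z)`, `T = {‖· − z‖∞ ≥ l'}`) bounds that by `θ_z^k`,
`θ_z = φ⁰_{Λ_N}[A_z crossed] ≤ φ⁰_{z + Λ_{N+2l}}[A_z crossed] = φ⁰_{Λ_{N+2l}}[A_0 crossed] ≤ θ₀`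
for `N + 2l ≥ N₀^{ANS}(l')` (increasing event: free-domain monotonicity
`rcMeasure_real_free_le_restrict` for `Λ_N ⊆ z + Λ_{N+2l}` inside `ℤ³`; translation invariance
`RandomClusterIsoInvariance` / boxes at arbitrary centres `RandomClusterShiftedBoxes`); union bound
over `z`; `θ := max θ₀ 0`. -/
theorem stub_clusterCountTight :
    (∀ (V : Type) [DecidableEq V] (G : SimpleGraph V) [DecidableRel G.Adj] (Λ : Finset V) (p q : ℝ),
      p ∈ Set.Icc (0 : ℝ) 1 → 1 ≤ q → ∀ (S T : Set ↥Λ) (k : ℕ),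
        (rcMeasure (G.comap (Subtype.val : ↥Λ → V)) p q (∅ : Set ↥Λ)).real
            {ω | ∃ x : Fin k → ↥Λ, (∀ i, x i ∈ S) ∧
              (∀ i j, i ≠ j → ¬ (openGraph ω).Reachable (x i) (x j)) ∧
              ∀ i, ∃ y ∈ T, (openGraph ω).Reachable (x i) y} ≤
          ((rcMeasure (G.comap (Subtype.val : ↥Λ → V)) p q (∅ : Set ↥Λ)).real
            {ω | ∃ x ∈ S, ∃ y ∈ T, (openGraph ω).Reachable x y}) ^ k) →
    (∃ ε θ : ℝ, 0 < ε ∧ θ < 1 ∧ ∀ l : ℕ, 1 ≤ l → ∃ N₀ : ℕ, ∀ N : ℕ, N₀ ≤ N →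
      (rcMeasure ((zdGraph 3).comap (Subtype.val : ↥(box 3 N) → Site 3))
          (fkIsingParam (criticalBeta 3)) 2 ∅).real
        {ω | ∃ x y : ↥(box 3 N), (∀ t, |(x : Site 3) t| ≤ ⌊ε * l⌋₊) ∧
          (∃ t, (l : ℤ) ≤ |(y : Site 3) t|) ∧ (openGraph ω).Reachable x y} ≤ θ) →
    ∀ ε : ℝ, 0 < ε → ∃ (M : ℕ) (θ : ℝ), 0 ≤ θ ∧ θ < 1 ∧ ∀ l : ℕ, 1 ≤ l → ∃ N₀ : ℕ, ∀ N : ℕ, N₀ ≤ N →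
      ∀ k : ℕ,
        (rcMeasure ((zdGraph 3).comap (Subtype.val : ↥(box 3 N) → Site 3))
            (fkIsingParam (criticalBeta 3)) 2 ∅).real
          {ω | ∃ x : Fin (M * k) → ↥(box 3 N), (∀ i t, |(x i : Site 3) t| ≤ l) ∧
            (∀ i j, i ≠ j → ¬ (openGraph ω).Reachable (x i) (x j)) ∧
            ∀ i, ∃ y : ↥(box 3 N), (∃ t, (⌈ε * l⌉₊ : ℤ) ≤ |(y : Site 3) t - (x i : Site 3) t|) ∧
              (openGraph ω).Reachable (x i) y} ≤ M * θ ^ k := by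
  sorry

/-- STUB AVG4 (L, provable now GIVEN its antecedent) — `ClusterCountTight → FourthMomentBound`,
inlined: for every `ε > 0` there is `c > 0` with
`c · (Σ_{x,y ∈ B_l, ‖x−y‖∞ ≥ ⌈εl⌉} φ_N[x↔y])² ≤ Σ_{x ∈ B_l⁴} φ_N[x joined]` for `l ≥ 1`, `N ≥ N₀(l)`.
Proof route (BCKS fourth moment, no two-point regularity needed), all sums finite
(`rcMeasure_real_apply`: the measure is a finite sum of point masses, so `φ.real A = Σ_ω w(ω) 1_A(ω)`
and both sides are expectations): with `m(x₀) := #{x ∈ B_l : x₀ ↔ x}` the right side is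
`E Σ_{x₀ ∈ B_l} m(x₀)³ = E Σ_C m_C⁴` (`m_C = |C ∩ B_l|`); with `f(x₀) := #{y ∈ B_l : ‖y − x₀‖∞ ≥ r, x₀ ↔ y}`
(`r = ⌈εl⌉`) the left expectation is `E X`, `X := Σ_{x₀} f(x₀)`.  Pointwise: let `Big` be the set of
clusters `C` with some `x₀ ∈ C ∩ B_l`, `f(x₀) ≥ 1`, `N := #Big`; then
`X = Σ_{C ∈ Big} Σ_{x₀ ∈ C} f(x₀)`, and by Cauchy–Schwarz twice
`X² ≤ N · Σ_{C ∈ Big} (Σ_{x₀∈C} f(x₀))² ≤ N · Σ_C m_C · Σ_{x₀ ∈ C} f(x₀)² ≤ N · Σ_{x₀} m(x₀)³`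
(`f ≤ m`).  Hence `E X ≤ E[√N · √(Σ m³)] ≤ √(E N) · √(E Σ m³)`, i.e. `S2far² ≤ E[N] · F4all`.
Finally `{N ≥ n} ⊆` the TIGHT event with `n` points (one point `x₀` with `f(x₀) ≥ 1` per big cluster:
pairwise disconnected, each joined to sup-distance `≥ r`), so with `(M, θ)` from TIGHT at this `ε`:
`E N = Σ_{n≥1} φ[N ≥ n] ≤ Σ_{k≥0} M · φ[N ≥ M·k] ≤ Σ_k M · min(1, M θ^k) ≤ M²/(1−θ)`;
`c := (1−θ)/M²`.  (`N ≤ (2l+1)³`, so all sums are finite; for `⌈εl⌉ > 2l` the left side is `0`.) -/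
theorem stub_fourthMomentBound :
    (∀ ε : ℝ, 0 < ε → ∃ (M : ℕ) (θ : ℝ), 0 ≤ θ ∧ θ < 1 ∧ ∀ l : ℕ, 1 ≤ l → ∃ N₀ : ℕ, ∀ N : ℕ, N₀ ≤ N →
      ∀ k : ℕ,
        (rcMeasure ((zdGraph 3).comap (Subtype.val : ↥(box 3 N) → Site 3))
            (fkIsingParam (criticalBeta 3)) 2 ∅).real
          {ω | ∃ x : Fin (M * k) → ↥(box 3 N), (∀ i t, |(x i : Site 3) t| ≤ l) ∧
            (∀ i j, i ≠ j → ¬ (openGraph ω).Reachable (x i) (x j)) ∧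
            ∀ i, ∃ y : ↥(box 3 N), (∃ t, (⌈ε * l⌉₊ : ℤ) ≤ |(y : Site 3) t - (x i : Site 3) t|) ∧
              (openGraph ω).Reachable (x i) y} ≤ M * θ ^ k) →
    ∀ ε : ℝ, 0 < ε → ∃ c : ℝ, 0 < c ∧ ∀ l : ℕ, 1 ≤ l → ∃ N₀ : ℕ, ∀ N : ℕ, N₀ ≤ N →
      c * (∑ x : ↥(box 3 N), ∑ y : ↥(box 3 N),
            if (∀ t, |(x : Site 3) t| ≤ l) ∧ (∀ t, |(y : Site 3) t| ≤ l) ∧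
                (∃ t, (⌈ε * l⌉₊ : ℤ) ≤ |(x : Site 3) t - (y : Site 3) t|)
            then (rcMeasure ((zdGraph 3).comap (Subtype.val : ↥(box 3 N) → Site 3))
                    (fkIsingParam (criticalBeta 3)) 2 ∅).real (openConn x y) else 0) ^ 2 ≤
        ∑ x : Fin 4 → ↥(box 3 N),
          if (∀ i t, |(x i : Site 3) t| ≤ l)
          then (rcMeasure ((zdGraph 3).comap (Subtype.val : ↥(box 3 N) → Site 3))
                  (fkIsingParam (criticalBeta 3)) 2 ∅).real
              {ω | ∀ i j, (openGraph ω).Reachable (x i) (x j)} else 0 := by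
  sorry

/-- STUB CMP (M, provable now; NO doubling input) — `FarPairComparison`, inlined: for
`0 < ε ≤ 1/8` there is `c > 0` such that for `l ≥ 1`, `N ≥ N₀(l)` and all `u, v ∈ B_l` with
`‖u − v‖∞ ≥ l`: `c · l⁶ · φ_N[u ↔ v] ≤ Σ_{x,y ∈ B_l, ‖x−y‖∞ ≥ ⌈εl⌉} φ_N[x ↔ y]`.
Proof route: (1) `φ_N[x ↔ y] = ⟨σ_xσ_y⟩^free_{Λ_N;β_c}` — Edwards–Sokal on the box graph
(`edwardsSokal_twoPoint_holds`, `fkIsingParam β = 1 − e^{−2β}` by `rfl`) and transport box graph ↔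
`ℤ³`-in-the-box (`isingTwoPoint_free_map`, exactly as `Disproof.isingTwoPoint_boxGraph`).
(2) Box transfer (`BoxTwoPointTransfer.lean`): `⟨σ_uσ_v⟩^∅_{Λ_N} ≤ S^f(v−u)` always
(`isingTwoPoint_box_le_twoPointFree`), and for the finite set of pairs of `B_l`, eventually in `N`,
`½ S^f(y−x) ≤ ⟨σ_xσ_y⟩^∅_{Λ_N}` (`eventually_box_twoPoint_approx`, `η = ½`) — this fixes `N₀(l)`.
(3) `S^f = S⁺` at `β_c` (`twoPointPlus_criticalBeta_eq_twoPointFree_holds`, ADS2015) and the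
Messager–Miracle-Solé sup-norm comparison `twoPointPlus_le_of_mul_supNorm_le` (ADC21 (5.3)):
`3‖y−x‖∞ ≤ ‖v−u‖∞ ⇒ S(v−u) ≤ S(y−x)` (or directly the free-state MMS of
`MessagerMiracleSoleFree.lean`).  (4) Counting: for `l ≥ 24` (say) the ordered pairs `x, y ∈ B_l`
with `⌈εl⌉ ≤ ‖y−x‖∞ ≤ ⌊l/3⌋` number `≥ l³ · #{z : ⌈εl⌉ ≤ ‖z‖∞ ≤ ⌊l/3⌋} ≥ c₀ l⁶` (`ε ≤ 1/8`), each
with `φ_N[x↔y] ≥ ½S(y−x) ≥ ½S(v−u) ≥ ½φ_N[u↔v]`, so `c = c₀/2`; for the finitely many `l < 24` use one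
far pair and positivity: `S2far ≥ φ_N[x₀↔y₀] ≥ ½ S(y₀−x₀) ≥ ½ min_{‖z‖∞ ≤ 48} S(z) > 0`
(`criticalTwoPoint_bounds_holds`, lower bound) while `l⁶ φ_N[u↔v] ≤ 24⁶`; take the minimum of the
finitely many constants.  (`N₀(l) ≥ l`, so `B_l ⊆ Λ_N`; for `2N < l` the hypothesis is void anyway.) -/
theorem stub_farPairComparison :
    ∀ ε : ℝ, 0 < ε → ε ≤ 1 / 8 → ∃ c : ℝ, 0 < c ∧ ∀ l : ℕ, 1 ≤ l → ∃ N₀ : ℕ, ∀ N : ℕ, N₀ ≤ N →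
      ∀ u v : ↥(box 3 N), (∀ t, |(u : Site 3) t| ≤ l) → (∀ t, |(v : Site 3) t| ≤ l) →
        (∃ t, (l : ℤ) ≤ |(u : Site 3) t - (v : Site 3) t|) →
          c * (l : ℝ) ^ 6 *
              (rcMeasure ((zdGraph 3).comap (Subtype.val : ↥(box 3 N) → Site 3))
                  (fkIsingParam (criticalBeta 3)) 2 ∅).real (openConn u v) ≤
            ∑ x : ↥(box 3 N), ∑ y : ↥(box 3 N),
              if (∀ t, |(x : Site 3) t| ≤ l) ∧ (∀ t, |(y : Site 3) t| ≤ l) ∧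
                  (∃ t, (⌈ε * l⌉₊ : ℤ) ≤ |(x : Site 3) t - (y : Site 3) t|)
              then (rcMeasure ((zdGraph 3).comap (Subtype.val : ↥(box 3 N) → Site 3))
                      (fkIsingParam (criticalBeta 3)) 2 ∅).real (openConn x y) else 0 := by
  sorry

/-- STUB ST (OPEN, LOAD-BEARING, the hardest stub; d = 3 critical input no. 2) —
`NoColdTetrahedron`, inlined: there is `C` such that for every `l ≥ 1`, all large `N` and the
tetrahedron `a = l·tetra`:
`Σ_{x ∈ B_l⁴} φ_N[x₀,x₁,x₂,x₃ all joined] ≤ C · l¹² · φ_N[a₀,a₁,a₂,a₃ all joined]`.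
Heuristics: under hyperscaling both sides are `≍ l¹² G(l)² ≍ l^{10−2η}` (clustered quadruples are
lower order: fusing two of four points at distance `s` gains only `(l/s)^{(1+η)/2}` against a volume
loss `(s/l)³`); in a massive phase it FAILS (Steiner tree of the tetrahedron `≈ 2.44·side` vs
quadruples at mutual distance `εl`), so it carries criticality; it is implied by the crux plus
UV-regularity of `G` (Lebowitz ceiling `P4 ≤ Σ_π GG`, landed `Negative/EdwardsSokalFour.lean`), and
it HOLDS in the `N(l) → ∞` enemy world where the crux fails (`F4all ≈ l¹²G²/N`, `P4(tetra) ≈ G²/N`)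
— so it is the crux minus the cluster-count half, not the crux.  `G`-free: it compares two
four-point quantities at the same scale (no exponent, no `η`).  Why it might fail: a genuinely
anomalous SHAPE dependence of `P4` among scale-`l` quadruples, or UV dominance of `F4all` by
near-coincident quadruples (no known mechanism for either).  Foreseen route: one-point Harnack for
`P4` (moving one corner by `≤ εl` within separated quadruples costs a constant — point-to-cluster
quasi-multiplicativity, the RSW-type input missing in d = 3; barrier
`TransverseCrossingsNeedNotMeet` applies to any crossing-gluing proof of it) + Lebowitz pruning of
non-separated quadruples using UV two-point regularity (`Σ_{‖z‖≤εl} G ≤ δ(ε) Σ_{‖z‖≤l} G`).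
Small `l` is harmless (`F4all ≤ (2l+1)¹²`, `P4(a) ≥ ⅛ S(a₁−a₀)S(a₂−a₁)S(a₃−a₂) > 0` by FKG and the
box transfer, uniformly in `N ≥ N₀(l)`): the content is asymptotic.
Cheapest falsifier: `R_ST(l) = E Σ_C |C ∩ B_l|⁴ / (l¹² · P4(A_l))` bounded in `l` on SW samples. -/
theorem stub_noColdTetrahedron :
    ∃ C : ℝ, ∀ l : ℕ, 1 ≤ l → ∃ N₀ : ℕ, ∀ N : ℕ, N₀ ≤ N → ∀ a : Fin 4 → ↥(box 3 N),
      (∀ i, ((a i : Site 3)) = (l : ℤ) • (![![-1, -1, -1], ![1, 1, -1], ![1, -1, 1], ![-1, 1, 1]] :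
        Fin 4 → Site 3) i) →
        (∑ x : Fin 4 → ↥(box 3 N),
            if (∀ i t, |(x i : Site 3) t| ≤ l)
            then (rcMeasure ((zdGraph 3).comap (Subtype.val : ↥(box 3 N) → Site 3))
                    (fkIsingParam (criticalBeta 3)) 2 ∅).real
                {ω | ∀ i j, (openGraph ω).Reachable (x i) (x j)} else 0) ≤
          C * (l : ℝ) ^ 12 *
            (rcMeasure ((zdGraph 3).comap (Subtype.val : ↥(box 3 N) → Site 3))
                (fkIsingParam (criticalBeta 3)) 2 ∅).real
              {ω | ∀ i j, (openGraph ω).Reachable (a i) (a j)} := by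
  sorry

/-! ### Consistency: each named statement IS its registered stub (definitionally) -/

theorem disjointCrossingTail_holds : DisjointCrossingTail := stub_disjointCrossingTail
theorem annulusNotSure_holds : AnnulusNotSure := stub_annulusNotSure
theorem clusterCountTight_holds : DisjointCrossingTail → AnnulusNotSure → ClusterCountTight :=
  stub_clusterCountTight
theorem fourthMomentBound_holds : ClusterCountTight → FourthMomentBound := stub_fourthMomentBound
theorem farPairComparison_holds : FarPairComparison := stub_farPairComparison
theorem noColdTetrahedron_holds : NoColdTetrahedron := stub_noColdTetrahedron

/-! ### Name-keyed aliases of the stub statements (the hypotheses of the composition) -/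
namespace Registered

/-- Alias of `DisjointCrossingTail` keyed by the registered stub name. -/
abbrev stub_disjointCrossingTail : Prop := DisjointCrossingTail
/-- Alias of `AnnulusNotSure` keyed by the registered stub name. -/
abbrev stub_annulusNotSure : Prop := AnnulusNotSure
/-- Alias of `DisjointCrossingTail → AnnulusNotSure → ClusterCountTight`. -/
abbrev stub_clusterCountTight : Prop := DisjointCrossingTail → AnnulusNotSure → ClusterCountTight
/-- Alias of `ClusterCountTight → FourthMomentBound`. -/
abbrev stub_fourthMomentBound : Prop := ClusterCountTight → FourthMomentBound
/-- Alias of `FarPairComparison`. -/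
abbrev stub_farPairComparison : Prop := FarPairComparison
/-- Alias of `NoColdTetrahedron`. -/
abbrev stub_noColdTetrahedron : Prop := NoColdTetrahedron

end Registered

/-! ### Small geometry of the tetrahedron (sorry-free) -/

/-- The corners `a = l·tetra` lie in the ball `B_l`. -/
theorem tetra_inBall {l N : ℕ} (a : Fin 4 → BoxV N) (ha : ∀ i, ((a i : Site 3)) = (l : ℤ) • tetra i)
    (i : Fin 4) : InBall l (a i : Site 3) := by
  intro t
  rw [ha i]
  fin_cases i <;> fin_cases t <;> simp [tetra]

/-- `a₀` and `a₁` are at sup-distance `2l ≥ l`. -/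
theorem tetra_far01 {l N : ℕ} (a : Fin 4 → BoxV N) (ha : ∀ i, ((a i : Site 3)) = (l : ℤ) • tetra i) :
    Far l (a 0 : Site 3) (a 1) := by
  refine ⟨0, ?_⟩
  rw [ha 0, ha 1]
  have : ((l : ℤ) • tetra 0) 0 - ((l : ℤ) • tetra 1) 0 = -(2 * l) := by simp [tetra]; ring
  rw [this, abs_neg, abs_of_nonneg (by positivity)]
  omega

/-- `a₂` and `a₃` are at sup-distance `2l ≥ l`. -/
theorem tetra_far23 {l N : ℕ} (a : Fin 4 → BoxV N) (ha : ∀ i, ((a i : Site 3)) = (l : ℤ) • tetra i) :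
    Far l (a 2 : Site 3) (a 3) := by
  refine ⟨0, ?_⟩
  rw [ha 2, ha 3]
  have : ((l : ℤ) • tetra 2) 0 - ((l : ℤ) • tetra 3) 0 = 2 * l := by simp [tetra]; ring
  rw [this, abs_of_nonneg (by positivity)]
  omega

/-! ### The composition: the stubs imply the crux, by name -/

/-- `FKFourConnectivity` from the stubs (real algebra, no `sorry`).  With `ε = 1/8`: AVG4 gives
`c₁ · S2far² ≤ F4all`, ST gives `F4all ≤ max C 1 · l¹² · P4(a)`, CMP gives
`c₂ l⁶ φ[a₀↔a₁] ≤ S2far` and `c₂ l⁶ φ[a₂↔a₃] ≤ S2far` (the tetrahedral pairs are far pairs of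
`B_l`); multiply, chain, cancel `l¹² > 0`: `(c₁c₂²/max C 1) · φ[a₀↔a₁] φ[a₂↔a₃] ≤ P4(a)` with
`N₀ = max` of the three thresholds.  TIGHT is obtained from DCT and ANS, AVG4 from TIGHT. -/
theorem FKFourConnectivity_of (hDCT : Registered.stub_disjointCrossingTail)
    (hANS : Registered.stub_annulusNotSure) (hTight : Registered.stub_clusterCountTight)
    (hAvg : Registered.stub_fourthMomentBound) (hCmp : Registered.stub_farPairComparison)
    (hST : Registered.stub_noColdTetrahedron) :
    Summit.CriticalPhenomena.Ising3DConformalLimit.Theses.FKParityRobustness.FKFourConnectivity := by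
  have hT : ClusterCountTight := hTight hDCT hANS
  have hA : FourthMomentBound := hAvg hT
  have hC : FarPairComparison := hCmp
  have hε : (0 : ℝ) < 1 / 8 := by norm_num
  obtain ⟨c₁, hc₁, hA1⟩ := hA (1 / 8) hε
  obtain ⟨c₂, hc₂, hC1⟩ := hC (1 / 8) hε le_rfl
  obtain ⟨C, hS⟩ := hST
  have hM : (0 : ℝ) < max C 1 := lt_of_lt_of_le one_pos (le_max_right C 1)
  unfold FKFourConnectivity
  intro tetra'
  refine ⟨c₁ * c₂ ^ 2 / max C 1, div_pos (mul_pos hc₁ (pow_pos hc₂ 2)) hM, fun l hl => ?_⟩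
  obtain ⟨N₁, hN₁⟩ := hA1 l hl
  obtain ⟨N₂, hN₂⟩ := hC1 l hl
  obtain ⟨N₃, hN₃⟩ := hS l hl
  refine ⟨max N₁ (max N₂ N₃), fun N hN a ha => ?_⟩
  have hn1 : N₁ ≤ N := le_trans (le_max_left _ _) hN
  have hn2 : N₂ ≤ N := le_trans (le_trans (le_max_left _ _) (le_max_right _ _)) hN
  have hn3 : N₃ ≤ N := le_trans (le_trans (le_max_right _ _) (le_max_right _ _)) hN
  have ha' : ∀ i, ((a i : Site 3)) = (l : ℤ) • tetra i := ha
  have h1 : c₁ * S2far N l ⌈(1 / 8 : ℝ) * l⌉₊ ^ 2 ≤ F4all N l := hN₁ N hn1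
  have h2 : c₂ * (l : ℝ) ^ 6 * Gtwo N (a 0) (a 1) ≤ S2far N l ⌈(1 / 8 : ℝ) * l⌉₊ :=
    hN₂ N hn2 (a 0) (a 1) (tetra_inBall a ha' 0) (tetra_inBall a ha' 1) (tetra_far01 a ha')
  have h3 : c₂ * (l : ℝ) ^ 6 * Gtwo N (a 2) (a 3) ≤ S2far N l ⌈(1 / 8 : ℝ) * l⌉₊ :=
    hN₂ N hn2 (a 2) (a 3) (tetra_inBall a ha' 2) (tetra_inBall a ha' 3) (tetra_far23 a ha')
  have h4 : F4all N l ≤ C * (l : ℝ) ^ 12 * P4 N a := hN₃ N hn3 a ha'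
  have hl0 : (0 : ℝ) < l := by exact_mod_cast hl
  have hl12 : (0 : ℝ) < (l : ℝ) ^ 12 := pow_pos hl0 12
  have hG01 : 0 ≤ Gtwo N (a 0) (a 1) := Gtwo_nonneg N (a 0) (a 1)
  have hG23 : 0 ≤ Gtwo N (a 2) (a 3) := Gtwo_nonneg N (a 2) (a 3)
  have hP4 : 0 ≤ P4 N a := P4_nonneg N a
  have hq01 : 0 ≤ c₂ * (l : ℝ) ^ 6 * Gtwo N (a 0) (a 1) :=
    mul_nonneg (mul_nonneg hc₂.le (pow_nonneg hl0.le 6)) hG01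
  have hq23 : 0 ≤ c₂ * (l : ℝ) ^ 6 * Gtwo N (a 2) (a 3) :=
    mul_nonneg (mul_nonneg hc₂.le (pow_nonneg hl0.le 6)) hG23
  have hS2 : 0 ≤ S2far N l ⌈(1 / 8 : ℝ) * l⌉₊ := le_trans hq01 h2
  have h5 : (c₂ * (l : ℝ) ^ 6 * Gtwo N (a 0) (a 1)) * (c₂ * (l : ℝ) ^ 6 * Gtwo N (a 2) (a 3)) ≤
      S2far N l ⌈(1 / 8 : ℝ) * l⌉₊ * S2far N l ⌈(1 / 8 : ℝ) * l⌉₊ :=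
    mul_le_mul h2 h3 hq23 hS2
  have h6 : C * (l : ℝ) ^ 12 * P4 N a ≤ max C 1 * (l : ℝ) ^ 12 * P4 N a :=
    mul_le_mul_of_nonneg_right (mul_le_mul_of_nonneg_right (le_max_left C 1) hl12.le) hP4
  have h7 : (c₁ * c₂ ^ 2 * (Gtwo N (a 0) (a 1) * Gtwo N (a 2) (a 3))) * (l : ℝ) ^ 12 ≤
      (P4 N a * max C 1) * (l : ℝ) ^ 12 :=
    calc (c₁ * c₂ ^ 2 * (Gtwo N (a 0) (a 1) * Gtwo N (a 2) (a 3))) * (l : ℝ) ^ 12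
        = c₁ * ((c₂ * (l : ℝ) ^ 6 * Gtwo N (a 0) (a 1)) * (c₂ * (l : ℝ) ^ 6 * Gtwo N (a 2) (a 3))) := by
          ring
      _ ≤ c₁ * (S2far N l ⌈(1 / 8 : ℝ) * l⌉₊ * S2far N l ⌈(1 / 8 : ℝ) * l⌉₊) :=
          mul_le_mul_of_nonneg_left h5 hc₁.le
      _ = c₁ * S2far N l ⌈(1 / 8 : ℝ) * l⌉₊ ^ 2 := by ring
      _ ≤ F4all N l := h1
      _ ≤ max C 1 * (l : ℝ) ^ 12 * P4 N a := h4.trans h6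
      _ = (P4 N a * max C 1) * (l : ℝ) ^ 12 := by ring
  have h8 : c₁ * c₂ ^ 2 * (Gtwo N (a 0) (a 1) * Gtwo N (a 2) (a 3)) ≤ P4 N a * max C 1 :=
    le_of_mul_le_mul_right h7 hl12
  show c₁ * c₂ ^ 2 / max C 1 * Gtwo N (a 0) (a 1) * Gtwo N (a 2) (a 3) ≤ P4 N a
  rw [div_mul_eq_mul_div, div_mul_eq_mul_div, div_le_iff₀ hM]
  calc c₁ * c₂ ^ 2 * Gtwo N (a 0) (a 1) * Gtwo N (a 2) (a 3)
      = c₁ * c₂ ^ 2 * (Gtwo N (a 0) (a 1) * Gtwo N (a 2) (a 3)) := by ring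
    _ ≤ P4 N a * max C 1 := h8

/-- Wiring check: the registered (verbatim) stubs feed `FKFourConnectivity_of` as stated — the crux
modulo exactly the six `stub_*` sorries. -/
theorem FKFourConnectivity_proof :
    Summit.CriticalPhenomena.Ising3DConformalLimit.Theses.FKParityRobustness.FKFourConnectivity :=
  FKFourConnectivity_of stub_disjointCrossingTail stub_annulusNotSure stub_clusterCountTight
    stub_fourthMomentBound stub_farPairComparison stub_noColdTetrahedron

/-- Read-back: the crux IS the statement `∃ c > 0 ∀ l ≥ 1 ∃ N₀ ∀ N ≥ N₀ ∀ a = l·tetra,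
c · Gtwo(a₀,a₁) · Gtwo(a₂,a₃) ≤ P4(a)` in this file's vocabulary (definitional). -/
example : Summit.CriticalPhenomena.Ising3DConformalLimit.Theses.FKParityRobustness.FKFourConnectivity ↔
    (∃ c : ℝ, 0 < c ∧ ∀ l : ℕ, 1 ≤ l → ∃ N₀ : ℕ, ∀ N : ℕ, N₀ ≤ N → ∀ a : Fin 4 → BoxV N,
      (∀ i, ((a i : Site 3)) = (l : ℤ) • tetra i) → c * Gtwo N (a 0) (a 1) * Gtwo N (a 2) (a 3) ≤ P4 N a) :=
  Iff.rfl

/-- Read-back: the crux's box graph is the tree's `finsetGraph (zdGraph 3) (box 3 N)` (so DCT and the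
free domain-Markov / domain-monotonicity lemmas of `RandomClusterDomainMarkovFree.lean` apply to
`phiN N` verbatim). -/
example (N : ℕ) : boxGraph N = finsetGraph (zdGraph 3) (box 3 N) := rfl

end Summit.CriticalPhenomena.Ising3DConformalLimit.Cruxes.FKFourConnectivity.DisjointCrossingTails

end
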